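import Literature.NumberTheory.Automorphic.CompactSubgroupAveraging
import Literature.NumberTheory.Automorphic.GLnCuspidalSpectrumProofs
import HarnessLib

/-!
# Averaging vectors over a compact subgroup: the projection onto `K`-fixed vectors as an
# approximate identity; the levels `ι_v(U_m)` of `GL_n(K_v)`
(Bernstein–Zelevinsky, *Representations of the group `GL(n, F)` where `F` is a non-archimedean
local field* (1976), §2: the idempotents `e_K` and `V = ⋃_K V^K`; Deitmar–Echterhoff,
*Principles of harmonic analysis* (2014), Lemma 9.2.7 (approximate identities); Bump (1997), §3.3)

Topic `NumberTheory/Automorphic`; one definition with body (`ContRepresentation.vectorAverage`) and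
theorems; no named fact, no instance visible to importers.

For a unitary strongly continuous representation `π` of a topological group `G` on a complex
Hilbert space `H` and a compact subgroup `K ≤ G`, the **`K`-average**
`P_K v = ∫_K π(k) v dk` (Haar probability measure of `K`, `subgroupHaar` of
`CompactSubgroupAveraging`) is the idempotent `e_K` of Bernstein–Zelevinsky acting on `H`:

* `ContRepresentation.apply_vectorAverage` — `π(k₀) P_K v = P_K v` (`P_K v` is `K`-fixed);
* `ContRepresentation.vectorAverage_eq_self` — `P_K v = v` if `v` is `K`-fixed;
* `ContRepresentation.norm_vectorAverage_sub_le` — **approximate identity**: if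
  `‖π(k) v - v‖ ≤ δ` on `K` then `‖P_K v - v‖ ≤ δ`;
* `ContRepresentation.apply_vectorAverage_comm` — `P_K` commutes with every bounded operator
  commuting with the `π(k)`, `k ∈ K` (e.g. with `π(g)` for `g` centralising `K`);
* `ContRepresentation.vectorAverage_add/_smul`, `…norm_vectorAverage_le` — linearity and
  `‖P_K v‖ ≤ ‖v‖`.

For `G = GL_n(𝔸_K)` and the compact open levels `U_m = 1 + ϖ_v^m M_n(𝒪_v)` of `GL_n(K_v)`
(`localCongruenceSubgroup`), embedded by `ι_v` (`GLn.toAdelic`):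

* `isCompact_map_toAdelic` — `ι_v(U)` is compact for `U` compact;
* `exists_norm_vectorAverage_localCongruenceSubgroup_sub_lt` — **`P_{ι_v(U_m)} v → v`**: for every
  `v` and `ε > 0` there is `m` with `‖P_{ι_v(U_m)} v - v‖ < ε` (strong continuity at `1` and
  `exists_localCongruenceSubgroup_subset`);
* `toContRep_toAdelic_vectorAverage_of_ne` — **`P_{ι_v(U)}` commutes with `ι_w(GL_n(K_w))` for
  `w ≠ v`** (`GLn.toAdelic_mul_eq_mul_toAdelic`, `GLn.toLocal_ofLocal_of_ne`).

These serve to move a local component `F : V_ρ → Π` at a place `w` into the `ι_v(U)`-fixed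
vectors at another place `v` without losing the `GL_n(K_w)`-equivariance (`P_{ι_v(U)} ∘ F`).

## References

* I. N. Bernstein, A. V. Zelevinsky, *Representations of the group `GL(n, F)` where `F` is a
  non-archimedean local field*, Russian Math. Surveys 31:3 (1976), §2 [BernsteinZelevinsky1976].
* A. Deitmar, S. Echterhoff, *Principles of harmonic analysis*, 2nd ed. (2014), Lemma 9.2.7
  [DeitmarEchterhoff2014].
* D. Bump, *Automorphic Forms and Representations* (1997), §3.3 [Bump1997].
-/

noncomputable section

open MeasureTheory Measure Set Filter Topology IsDedekindDomain NumberField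
open Literature.NumberTheory.Automorphic

namespace ContRepresentation

section Average

variable {G H : Type*} [Group G] [TopologicalSpace G] [IsTopologicalGroup G]
  [MeasurableSpace G] [BorelSpace G]
  [NormedAddCommGroup H] [InnerProductSpace ℂ H] [CompleteSpace H]
  (π : ContRepresentation ℂ G H) (K : Subgroup G) (hK : IsCompact (K : Set G))

/-- The **`K`-average** `P_K v = ∫_K π(k) v dk` of a vector over a compact subgroup `K` (Haar
probability measure of `K`; Bernstein–Zelevinsky's idempotent `e_K` acting on `H`).
[cite: BernsteinZelevinsky1976, §2] -/
def vectorAverage (v : H) : H :=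
  ∫ k : K, π (k : G) v ∂(subgroupHaar K hK)

variable {π K hK}

omit [CompleteSpace H] in
/-- Unfolding of `vectorAverage`. [folklore] -/
theorem vectorAverage_apply (v : H) :
    π.vectorAverage K hK v = ∫ k : K, π (k : G) v ∂(subgroupHaar K hK) := rfl

omit [CompleteSpace H] in
/-- The integrand `k ↦ π(k) v` is integrable on the compact group `K` (strong continuity).
[folklore] -/
theorem integrable_apply_coe (hc : π.IsStronglyContinuous) (v : H) :
    Integrable (fun k : K => π (k : G) v) (subgroupHaar K hK) := by
  haveI := compactSpace_subgroup K hK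
  exact ((hc v).comp continuous_subtype_val).integrable_of_hasCompactSupport
    (HasCompactSupport.of_compactSpace _)

omit [CompleteSpace H] in
/-- `P_K` is additive. [folklore] -/
theorem vectorAverage_add (hc : π.IsStronglyContinuous) (v w : H) :
    π.vectorAverage K hK (v + w) = π.vectorAverage K hK v + π.vectorAverage K hK w := by
  simp only [vectorAverage_apply, map_add]
  exact integral_add (integrable_apply_coe hc v) (integrable_apply_coe hc w)

omit [CompleteSpace H] in
/-- `P_K` is homogeneous. [folklore] -/
theorem vectorAverage_smul (c : ℂ) (v : H) :
    π.vectorAverage K hK (c • v) = c • π.vectorAverage K hK v := by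
  simp only [vectorAverage_apply, map_smul]
  exact integral_smul c _

/-- `‖P_K v‖ ≤ ‖v‖` for `π` unitary. [folklore] -/
theorem norm_vectorAverage_le (hu : π.IsUnitary) (v : H) : ‖π.vectorAverage K hK v‖ ≤ ‖v‖ := by
  rw [vectorAverage_apply]
  calc ‖∫ k : K, π (k : G) v ∂(subgroupHaar K hK)‖
      ≤ ‖v‖ * ((subgroupHaar K hK) Set.univ).toReal :=
        norm_integral_le_of_norm_le_const (Eventually.of_forall fun k => (hu.norm_map _ v).le)
    _ = ‖v‖ := by rw [measure_univ, ENNReal.toReal_one, mul_one]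

/-- **`P_K v` is `K`-fixed**: `π(k₀) P_K v = P_K v` for `k₀ ∈ K` (left invariance of the Haar
measure of `K`). [cite: BernsteinZelevinsky1976, §2] -/
theorem apply_vectorAverage (hc : π.IsStronglyContinuous) {k₀ : G} (hk₀ : k₀ ∈ K) (v : H) :
    π k₀ (π.vectorAverage K hK v) = π.vectorAverage K hK v := by
  rw [vectorAverage_apply, ← ContinuousLinearMap.integral_comp_comm (π k₀) (integrable_apply_coe hc v)]
  have h := integral_mul_left_eq_self (μ := subgroupHaar K hK) (fun k : K => π (k : G) v) ⟨k₀, hk₀⟩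
  rw [← h]
  congr 1 with k
  change π k₀ (π (k : G) v) = π ((⟨k₀, hk₀⟩ * k : K) : G) v
  rw [Subgroup.coe_mul, map_mul π]
  rfl

/-- `P_K v` lies in the `K`-fixed vectors. [cite: BernsteinZelevinsky1976, §2] -/
theorem vectorAverage_mem_fixed (hc : π.IsStronglyContinuous) (v : H) :
    ∀ k ∈ K, π k (π.vectorAverage K hK v) = π.vectorAverage K hK v := fun _ hk =>
  apply_vectorAverage hc hk v

/-- **`P_K v = v` for `K`-fixed `v`** (the measure of `K` is one). [cite: BernsteinZelevinsky1976, §2] -/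
theorem vectorAverage_eq_self {v : H} (hv : ∀ k ∈ K, π k v = v) : π.vectorAverage K hK v = v := by
  rw [vectorAverage_apply]
  have h : (fun k : K => π (k : G) v) = fun _ => v := funext fun k => hv k k.2
  rw [h, integral_const, probReal_univ, one_smul]

/-- `P_K ∘ P_K = P_K`. [cite: BernsteinZelevinsky1976, §2] -/
theorem vectorAverage_vectorAverage (hc : π.IsStronglyContinuous) (v : H) :
    π.vectorAverage K hK (π.vectorAverage K hK v) = π.vectorAverage K hK v :=
  vectorAverage_eq_self (vectorAverage_mem_fixed hc v)

/-- **`P_K` is an approximate identity**: if `‖π(k) v - v‖ ≤ δ` for all `k ∈ K` then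
`‖P_K v - v‖ ≤ δ` (`P_K v - v = ∫_K (π(k) v - v) dk` against a probability measure;
Deitmar–Echterhoff (2014), Lemma 9.2.7). [cite: DeitmarEchterhoff2014, Lemma 9.2.7] -/
theorem norm_vectorAverage_sub_le (hc : π.IsStronglyContinuous) {v : H} {δ : ℝ}
    (hδ : ∀ k ∈ K, ‖π k v - v‖ ≤ δ) : ‖π.vectorAverage K hK v - v‖ ≤ δ := by
  have h : π.vectorAverage K hK v - v = ∫ k : K, (π (k : G) v - v) ∂(subgroupHaar K hK) := by
    rw [integral_sub (integrable_apply_coe hc v) (integrable_const v), integral_const,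
      probReal_univ, one_smul, vectorAverage_apply]
  rw [h]
  calc ‖∫ k : K, (π (k : G) v - v) ∂(subgroupHaar K hK)‖
      ≤ δ * ((subgroupHaar K hK) Set.univ).toReal :=
        norm_integral_le_of_norm_le_const (Eventually.of_forall fun k => hδ k k.2)
    _ = δ := by rw [measure_univ, ENNReal.toReal_one, mul_one]

/-- **`P_K` commutes with the commutant of `π(K)`**: if a bounded `T` satisfies
`T (π(k) x) = π(k) (T x)` for `k ∈ K` then `T (P_K v) = P_K (T v)` (Bochner integrals commute with
bounded operators). [folklore] -/
theorem apply_vectorAverage_comm (hc : π.IsStronglyContinuous) (T : H →L[ℂ] H)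
    (hT : ∀ k ∈ K, ∀ x : H, T (π k x) = π k (T x)) (v : H) :
    T (π.vectorAverage K hK v) = π.vectorAverage K hK (T v) := by
  rw [vectorAverage_apply, vectorAverage_apply,
    ← ContinuousLinearMap.integral_comp_comm T (integrable_apply_coe hc v)]
  congr 1 with k
  exact hT k k.2 v

/-- In particular `π(g) P_K v = P_K (π(g) v)` for `g` commuting with every element of `K`.
[folklore] -/
theorem apply_vectorAverage_of_commute (hc : π.IsStronglyContinuous) {g : G}
    (hg : ∀ k ∈ K, g * k = k * g) (v : H) :
    π g (π.vectorAverage K hK v) = π.vectorAverage K hK (π g v) := by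
  refine apply_vectorAverage_comm hc (π g) (fun k hk x => ?_) v
  have h : π g * π k = π k * π g := by rw [← map_mul π, hg k hk, map_mul π]
  exact congrArg (fun T : H →L[ℂ] H => T x) h

end Average

end ContRepresentation

/-! ### `GL_n`: the levels `ι_v(U_m)` -/

namespace Literature.NumberTheory.Automorphic

section GLn

variable {n : ℕ} {K : Type} [Field K] [NumberField K] {v : HeightOneSpectrum (𝓞 K)}
  {μ : Measure (AdelicGroupData.gl n K).automorphicQuotient}
  [(AdelicGroupData.gl n K).IsAutomorphicMeasure μ]

attribute [local instance] adelicBorel borelSpace_adelic locallyCompactSpace_adelic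
  secondCountableTopology_gl_adelic

/-- `ι_v(U)` is compact for `U` compact. [folklore] -/
theorem isCompact_map_toAdelic {U : Subgroup (GL (Fin n) (v.adicCompletion K))}
    (hU : IsCompact (U : Set (GL (Fin n) (v.adicCompletion K)))) :
    IsCompact ((U.map (GLn.toAdelic n K v) : Subgroup (AdelicGroupData.gl n K).Adelic) :
      Set (AdelicGroupData.gl n K).Adelic) := by
  rw [Subgroup.coe_map]
  exact hU.image (GLn.continuous_toAdelic n K v)

variable (W : ContRepresentation.ClosedSubrep ((AdelicGroupData.gl n K).rightRegular μ))

/-- The restriction of the regular representation to a closed subrepresentation is strongly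
continuous (`continuous_toContRep_apply`). [folklore] -/
theorem isStronglyContinuous_toContRep : W.toContRep.IsStronglyContinuous := fun f =>
  continuous_toContRep_apply W f

/-- **`P_{ι_v(U_m)} f → f`**: for `f` in a closed subrepresentation `Π ≤ L²(GL_n(K) A_G \ GL_n(𝔸_K))`
and `ε > 0` there is a level `U_m = 1 + ϖ_v^m M_n(𝒪_v)` with `‖P_{ι_v(U_m)} f - f‖ < ε` (strong
continuity at `1` gives a neighbourhood on which `‖R(g) f - f‖ ≤ ε/2`; its preimage under `ι_v`
contains some `U_m`, `exists_localCongruenceSubgroup_subset`). [cite: BernsteinZelevinsky1976, §2] -/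
theorem exists_norm_vectorAverage_localCongruenceSubgroup_sub_lt (f : W.toSubmodule) {ε : ℝ}
    (hε : 0 < ε) :
    ∃ m : ℕ, ‖W.toContRep.vectorAverage
        ((localCongruenceSubgroup n K v m).map (GLn.toAdelic n K v))
        (isCompact_map_toAdelic (isCompact_localCongruenceSubgroup n K v m)) f - f‖ < ε := by
  have hcont : Continuous fun g : (AdelicGroupData.gl n K).Adelic => W.toContRep g f :=
    continuous_toContRep_apply W f
  set N : Set (AdelicGroupData.gl n K).Adelic := {g | ‖W.toContRep g f - f‖ < ε / 2} with hN
  have hNo : IsOpen N := isOpen_lt (hcont.sub continuous_const).norm continuous_const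
  have h1N : (1 : (AdelicGroupData.gl n K).Adelic) ∈ N := by
    change ‖W.toContRep 1 f - f‖ < ε / 2
    rw [map_one]
    change ‖f - f‖ < ε / 2
    rw [sub_self, norm_zero]
    exact half_pos hε
  have hpre : GLn.toAdelic n K v ⁻¹' N ∈ 𝓝 (1 : GL (Fin n) (v.adicCompletion K)) :=
    (GLn.continuous_toAdelic n K v).continuousAt.preimage_mem_nhds
      (by rw [map_one]; exact hNo.mem_nhds h1N)
  obtain ⟨m, hm⟩ := exists_localCongruenceSubgroup_subset n K v hpre
  refine ⟨m, ?_⟩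
  have hδ : ∀ k ∈ ((localCongruenceSubgroup n K v m).map (GLn.toAdelic n K v) :
      Subgroup (AdelicGroupData.gl n K).Adelic), ‖W.toContRep k f - f‖ ≤ ε / 2 := by
    rintro _ ⟨u, hu, rfl⟩
    exact le_of_lt (hm hu)
  exact (ContRepresentation.norm_vectorAverage_sub_le (isStronglyContinuous_toContRep W) hδ).trans_lt
    (half_lt_self hε)

/-- **`P_{ι_v(U)}` commutes with `R(ι_w a)` for `w ≠ v`**: the images of `ι_v` and `ι_w` commute
(`ι_w(a)` is trivial at `v`, `GLn.toLocal_ofLocal_of_ne`, and `ι_v(u)` commutes with every element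
trivial at `v`, `GLn.toAdelic_mul_eq_mul_toAdelic`). [folklore] -/
theorem toContRep_toAdelic_vectorAverage_of_ne {w : HeightOneSpectrum (𝓞 K)} (hwv : w ≠ v)
    {U : Subgroup (GL (Fin n) (v.adicCompletion K))}
    (hU : IsCompact (U : Set (GL (Fin n) (v.adicCompletion K))))
    (a : GL (Fin n) (w.adicCompletion K)) (f : W.toSubmodule) :
    W.toContRep (GLn.toAdelic n K w a)
        (W.toContRep.vectorAverage (U.map (GLn.toAdelic n K v)) (isCompact_map_toAdelic hU) f) =
      W.toContRep.vectorAverage (U.map (GLn.toAdelic n K v)) (isCompact_map_toAdelic hU)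
        (W.toContRep (GLn.toAdelic n K w a) f) := by
  refine ContRepresentation.apply_vectorAverage_of_commute (isStronglyContinuous_toContRep W)
    (fun k hk => ?_) f
  obtain ⟨u, -, rfl⟩ := hk
  have htriv : GLn.toLocalAt n K v (GLn.toAdelic n K w a) = 1 :=
    GLn.toLocal_ofLocal_of_ne hwv.symm a
  exact (GLn.toAdelic_mul_eq_mul_toAdelic htriv u).symm

end GLn

end Literature.NumberTheory.Automorphic
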